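import Mathlib
import Literature.Probability.LatticeModels.TemperleyLiebConnectivityBasis
import HarnessLib

/-!
# The small links `φ_i` of Ikhlef–Ponsaing on the connectivity basis

Topic `Literature/Probability/LatticeModels`. Ikhlef–Ponsaing (J. Stat. Phys. 149 (2012),
arXiv:1202.5476) Lemma 3.3 and recursion (21) use the insertion `φ_i : LP_{L-2} → LP_L` of a small
link between strands `i, i+1`. In the cluster (connectivity) language of
`TemperleyLiebConnectivityBasis.lean` (`NCState n` = non-crossing equivalence relations on the `n`
column sites, wall = class of site `0`) this is: for even `i = 2b`, insert a new singleton site at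
position `b` (`SiteRel.insertIso`, `NCState.insIso`); for odd `i = 2j+1`, split the site `j` into a
joined pair (`SiteRel.insertDup` = pullback along `Fin.predAbove j`, `NCState.insDup`). Both
preserve non-crossing equivalence relations (`IsNCEquiv.insertIso`, `IsNCEquiv.insertDup`, via the
general `IsNCEquiv.pullback` along monotone maps) and are injective; `phiState m i` packages IP12's
`φ_i : NCState m → NCState (m+1)`. These are the conventions under which Lemma 3.3,
`t_L(z_{i+1} = q z_i) ∘ φ_i = φ_i ∘ t_{L-2}(ẑ_i, ẑ_{i+1})`, holds for the cluster transfer matrix of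
`Literature/Probability/Percolation/DiagonalStripTransferInhomogeneous.lean` (verified numerically for
`m = 2, 3`; the Lean proof of Lemma 3.3 is not in this file).

## References

* Y. Ikhlef, A. K. Ponsaing, J. Stat. Phys. 149 (2012) 10–36, arXiv:1202.5476, Lemma 3.3, eq. (21).
  [IkhlefPonsaing2012]
-/

namespace Literature.Probability.LatticeModels.TemperleyLieb

variable {n n' : ℕ}

namespace SiteRel

/-! ### Pullback of relations along maps of sites -/

/-- Pull a relation back along a map of sites. [folklore] -/
def pullback (r : SiteRel n) (g : Fin n' → Fin n) : SiteRel n' := fun a b => r (g a) (g b)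

/-- Unfolding of `pullback`. [folklore] -/
@[simp] theorem pullback_apply (r : SiteRel n) (g : Fin n' → Fin n) (a b : Fin n') :
    r.pullback g a b = r (g a) (g b) := rfl

/-- **Pullback along a monotone map preserves non-crossing equivalence relations.** [folklore] -/
theorem IsNCEquiv.pullback {r : SiteRel n} (hr : r.IsNCEquiv) {g : Fin n' → Fin n} (hg : Monotone g) :
    (r.pullback g).IsNCEquiv := by
  refine ⟨fun i => hr.refl _, fun i j h => hr.symm _ _ h, fun i j k h1 h2 => hr.trans _ _ _ h1 h2,
    fun i j k l hij hjk hkl hik hjl => ?_⟩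
  simp only [pullback_apply] at hik hjl ⊢
  have h1 : g i ≤ g j := hg hij.le
  have h2 : g j ≤ g k := hg hjk.le
  have h3 : g k ≤ g l := hg hkl.le
  rcases h1.lt_or_eq with h1 | h1
  · rcases h2.lt_or_eq with h2 | h2
    · rcases h3.lt_or_eq with h3 | h3
      · exact hr.noncross _ _ _ _ h1 h2 h3 hik hjl
      · rw [← h3] at hjl
        exact hr.trans _ _ _ hik (hr.symm _ _ hjl)
    · rw [← h2] at hik; exact hik
  · rw [h1]; exact hr.refl _

/-! ### The two small-link insertions -/

/-- **Duplicate the site `j`**: the new site `j+1` carries the class of `j`; sites `> j` shift up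
(IP12's small link `φ_{2j+1}` in cluster language). [cite: IkhlefPonsaing2012, Lemma 3.3] -/
def insertDup (r : SiteRel n) (j : Fin n) : SiteRel (n + 1) := r.pullback j.predAbove

/-- **Insert a new singleton site at position `P`**; sites `≥ P` shift up (IP12's small link
`φ_{2b}`, `P = b`). [cite: IkhlefPonsaing2012, Lemma 3.3] -/
def insertIso (r : SiteRel n) (P : Fin (n + 1)) : SiteRel (n + 1) := fun a b =>
  decide (a = b) || decide (∃ a' b', P.succAbove a' = a ∧ P.succAbove b' = b ∧ r a' b' = true)

/-- Duplication preserves non-crossing equivalence relations. [folklore] -/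
theorem IsNCEquiv.insertDup {r : SiteRel n} (hr : r.IsNCEquiv) (j : Fin n) : (r.insertDup j).IsNCEquiv :=
  hr.pullback (Fin.predAbove_right_monotone j)

/-- `insertDup` on shifted sites. [folklore] -/
theorem insertDup_succAbove (r : SiteRel n) (j : Fin n) (a b : Fin n) :
    r.insertDup j ((Fin.castSucc j).succAbove a) ((Fin.castSucc j).succAbove b) = r a b := by
  simp [insertDup, Fin.predAbove_succAbove]

/-- The duplicated site is related to its original. [folklore] -/
theorem insertDup_castSucc_succ {r : SiteRel n} (hr : ∀ i, r i i = true) (j : Fin n) :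
    r.insertDup j (Fin.castSucc j) j.succ = true := by
  simp [insertDup, hr]

/-- `insertIso` on two shifted sites is the old relation (reflexive `r`). [folklore] -/
theorem insertIso_succAbove {r : SiteRel n} (hr : ∀ i, r i i = true) (P : Fin (n + 1)) (a b : Fin n) :
    r.insertIso P (P.succAbove a) (P.succAbove b) = r a b := by
  unfold insertIso
  rw [Bool.eq_iff_iff]
  simp only [Bool.or_eq_true, decide_eq_true_eq, Fin.succAbove_right_inj]
  constructor
  · rintro (rfl | ⟨a', b', ha, hb, h⟩)
    · exact hr a
    · subst ha; subst hb; exact h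
  · intro h; exact Or.inr ⟨a, b, rfl, rfl, h⟩

/-- The new site of `insertIso` is a singleton. [folklore] -/
theorem insertIso_self_left (r : SiteRel n) (P b : Fin (n + 1)) : r.insertIso P P b = decide (P = b) := by
  unfold insertIso
  rw [Bool.eq_iff_iff]
  simp only [Bool.or_eq_true, decide_eq_true_eq]
  constructor
  · rintro (h | ⟨a', b', ha, -, -⟩)
    · exact h
    · exact absurd ha (Fin.succAbove_ne P a')
  · exact fun h => Or.inl h

/-- The new site of `insertIso` is a singleton (right). [folklore] -/
theorem insertIso_self_right (r : SiteRel n) (P a : Fin (n + 1)) : r.insertIso P a P = decide (a = P) := by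
  unfold insertIso
  rw [Bool.eq_iff_iff]
  simp only [Bool.or_eq_true, decide_eq_true_eq]
  constructor
  · rintro (h | ⟨a', b', -, hb, -⟩)
    · exact h
    · exact absurd hb (Fin.succAbove_ne P b')
  · exact fun h => Or.inl h

/-- **Singleton insertion preserves non-crossing equivalence relations.** [folklore] -/
theorem IsNCEquiv.insertIso {r : SiteRel n} (hr : r.IsNCEquiv) (P : Fin (n + 1)) : (r.insertIso P).IsNCEquiv := by
  -- every site other than `P` is a shifted site
  have hlift : ∀ a : Fin (n + 1), a ≠ P → ∃ a', P.succAbove a' = a := fun a ha => Fin.exists_succAbove_eq ha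
  have key : ∀ a b : Fin (n + 1), r.insertIso P a b = true ↔
      a = b ∨ ∃ a' b', P.succAbove a' = a ∧ P.succAbove b' = b ∧ r a' b' = true := by
    intro a b; unfold SiteRel.insertIso; simp only [Bool.or_eq_true, decide_eq_true_eq]
  refine ⟨fun i => by rw [key]; exact Or.inl rfl, fun i j h => ?_, fun i j k h1 h2 => ?_,
    fun i j k l hij hjk hkl hik hjl => ?_⟩
  · rw [key] at h ⊢
    rcases h with rfl | ⟨a', b', ha, hb, h⟩
    · exact Or.inl rfl
    · exact Or.inr ⟨b', a', hb, ha, hr.symm _ _ h⟩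
  · rw [key] at h1 h2 ⊢
    rcases h1 with rfl | ⟨a', b', rfl, rfl, h1⟩
    · exact h2
    · rcases h2 with h2 | ⟨b'', c', hb, rfl, h2⟩
      · rw [← h2]; exact Or.inr ⟨a', b', rfl, rfl, h1⟩
      · rw [Fin.succAbove_right_inj] at hb
        subst hb
        exact Or.inr ⟨a', c', rfl, rfl, hr.trans _ _ _ h1 h2⟩
  · rw [key] at hik hjl ⊢
    rcases hik with hik | ⟨i', k', rfl, rfl, hik⟩
    · exact absurd (hik ▸ hij.trans hjk) (lt_irrefl _)
    rcases hjl with hjl | ⟨j', l', rfl, rfl, hjl⟩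
    · exact absurd (hjl ▸ hjk.trans hkl) (lt_irrefl _)
    refine Or.inr ⟨i', j', rfl, rfl, hr.noncross i' j' k' l' ?_ ?_ ?_ hik hjl⟩
    · exact (Fin.succAbove_lt_succAbove_iff).1 hij
    · exact (Fin.succAbove_lt_succAbove_iff).1 hjk
    · exact (Fin.succAbove_lt_succAbove_iff).1 hkl

end SiteRel

namespace NCState

/-- Duplicate a site (state level). [cite: IkhlefPonsaing2012, Lemma 3.3] -/
def insDup (j : Fin n) (s : NCState n) : NCState (n + 1) := ⟨s.1.insertDup j, s.2.insertDup j⟩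

/-- Insert a singleton site (state level). [cite: IkhlefPonsaing2012, Lemma 3.3] -/
def insIso (P : Fin (n + 1)) (s : NCState n) : NCState (n + 1) := ⟨s.1.insertIso P, s.2.insertIso P⟩

/-- Underlying relation of `insDup`. [folklore] -/
@[simp] theorem insDup_val (j : Fin n) (s : NCState n) : (insDup j s).1 = s.1.insertDup j := rfl

/-- Underlying relation of `insIso`. [folklore] -/
@[simp] theorem insIso_val (P : Fin (n + 1)) (s : NCState n) : (insIso P s).1 = s.1.insertIso P := rfl

/-- `insIso` is injective. [folklore] -/
theorem insIso_injective (P : Fin (n + 1)) : Function.Injective (insIso (n := n) P) := by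
  intro s t h
  apply Subtype.ext
  funext a b
  have := congrArg (fun u : NCState (n + 1) => u.1 (P.succAbove a) (P.succAbove b)) h
  simpa only [insIso_val, SiteRel.insertIso_succAbove s.2.refl, SiteRel.insertIso_succAbove t.2.refl] using this

/-- `insDup` is injective. [folklore] -/
theorem insDup_injective (j : Fin n) : Function.Injective (insDup (n := n) j) := by
  intro s t h
  apply Subtype.ext
  funext a b
  have := congrArg (fun u : NCState (n + 1) => u.1 ((Fin.castSucc j).succAbove a) ((Fin.castSucc j).succAbove b)) h
  simpa only [insDup_val, SiteRel.insertDup_succAbove] using this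

end NCState

/-! ### IP12's small link `φ_i` -/

section Phi

variable (m : ℕ)

/-- **The small link `φ_i : LP_{L-2} → LP_L`** (`L = 2m+1`, `1 ≤ i ≤ 2m`) on the connectivity basis:
for even `i = 2b` a new singleton site is inserted at position `b`; for odd `i = 2j+1` the site `j`
is split into a joined pair. (These are the conventions for which Lemma 3.3,
`t_L(z_{i+1} = q z_i) ∘ φ_i = φ_i ∘ t_{L-2}(ẑ_i, ẑ_{i+1})`, holds in the cluster language; checked
numerically for `m = 2, 3`.) [cite: IkhlefPonsaing2012, Lemma 3.3] -/
def phiState (i : ℕ) (hi : 1 ≤ i ∧ i ≤ 2 * m) : NCState m → NCState (m + 1) :=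
  if h : i % 2 = 0 then NCState.insIso ⟨i / 2, by omega⟩
  else NCState.insDup ⟨(i - 1) / 2, by omega⟩

/-- Even small links insert singletons. [folklore] -/
theorem phiState_of_even {i : ℕ} (hi : 1 ≤ i ∧ i ≤ 2 * m) (h : i % 2 = 0) :
    phiState m i hi = NCState.insIso ⟨i / 2, by omega⟩ := by
  simp [phiState, h]

/-- Odd small links duplicate. [folklore] -/
theorem phiState_of_odd {i : ℕ} (hi : 1 ≤ i ∧ i ≤ 2 * m) (h : i % 2 = 1) :
    phiState m i hi = NCState.insDup ⟨(i - 1) / 2, by omega⟩ := by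
  simp [phiState, h]

/-- **The small links are injective.** [folklore] -/
theorem phiState_injective {i : ℕ} (hi : 1 ≤ i ∧ i ≤ 2 * m) : Function.Injective (phiState m i hi) := by
  rcases Nat.mod_two_eq_zero_or_one i with h | h
  · rw [phiState_of_even m hi h]; exact NCState.insIso_injective _
  · rw [phiState_of_odd m hi h]; exact NCState.insDup_injective _

end Phi

end Literature.Probability.LatticeModels.TemperleyLieb
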